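import Summits.BirchSwinnertonDyer.BirchSwinnertonDyer.Theorems.SignedLowerHalvesSmallImageLowerHalfBothSignsRttD2SeqSemilocPhiKernel
import Literature.NumberTheory.GaloisRepresentations.GaloisH1MapBijectiveUnramified
import Summits.BirchSwinnertonDyer.BirchSwinnertonDyer.Theorems.SignedLowerHalvesSmallImageLowerHalfBothSignsRttD2SeqSemilocKernel
import HarnessLib

/-!
# Route `SignedLowerHalves`, crux L `SmallImageLowerHalfBothSigns` (stmt-BirchSwinnertonDyer-23599), line `rtt_w3` v30 — stub S3β″ (`stub_junctionPT_ns`, row J4′,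
# Poitou–Tate half), brick N5-(ii): THE `(S₀ ∖ P)`-UNRAMIFIED FAMILIES `H′ ≤ Π_{w∈S₀} 𝐇¹_{Iw,w}` AS A `Λ_𝒪`-SUBMODULE, and T5's kernel hypothesis `hPT` ON `H′`

WIDTH seat `bsd-line-slh-p3-w3` g26 under LEAD `cruxlead-stmt-BirchSwinnertonDyer-23599` g14 (cell `bsd-ssimc`); helper `--supports stmt-BirchSwinnertonDyer-23599`
(design memo `Lines/rtt_w3-DESIGN-S3beta-w3-g25.md`, rev 4 §5/§6 N5). DEFINITIONS WITH BODIES (`unramifiedLevelΛ`, `unramifiedFamilies`) + THEOREMS; no named fact, no instance, no `sorry`.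
For the CONSTRUCTED semilocal data `L w := semilocIwasawaCohomologyDataO S κ γ θ′ P w 1` (T1-b₂, p811191), whose `Λ_𝒪`-action is levelwise (`proj (F • y) = F •_{level} proj y`, definitional).
HONEST FRAMING: this is the definition of the module `H′` of T5's λ-assembly and the plumbing of its kernel hypothesis; the local count `λ(Λ_𝒪/(E)) ≤ λ(H′)` and the finiteness/torsion of
`Π 𝐇¹_{Iw,w}` (rest of N5) remain; nothing about S3β″, S3α′, crux L or BSD is proved; all remain OPEN and are proved for NO curve.

* §1 `semilocH_mem_unramifiedSubgroup` (every `H¹(res_w, φ)` for a `Γ_K`-endomorphism `φ` of `Maps(Γ_K ⧸ U_n, X_k)` preserves the unramified classes — `galoisCohomology.map_unramifiedSubgroup_le`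
  read in honda's dialect), `aeval_semilocPsi_mem` and ★ `unramifiedLevelΛ … n k : Submodule Λ_𝒪 Lloc_w(n,k)` (the unramified classes are a `Λ_𝒪`-submodule of the level for T1-b₂'s
  `semilocLayerModuleΛ`: stable under the `𝒪`-scalars and under `ψ_γ = R_γ − 1`, hence under every `F` by `LocallyNilpotent.smul_eq_aeval_trunc_apply`).
* §2 ★★ `unramifiedFamilies … S₀ : Submodule Λ_𝒪 (Π_{w:S₀} (L w).H)` — the families unramified at every level at the places of `S₀ ∖ P` (the `H′` of DESIGN §5), and ★★
  `mem_range_semilocMapPi_of_phiLocImage_eq_zero` — T5's `hPT` VERBATIM on `H′`: `x ∈ H′`, `Φ x = 0` ⇒ `x ∈ range sloc_{S₀}` (N2d (γ) `exists_semilocMap_eq_of_phiLocImage_eq_zero`).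
References: [Rubin2000] Thm. 1.7.3, App. B.3; [MilneADT2006] I §2, Thm. 4.10 (b); [Kaplansky1954] §19; [Kato2004Asterisque] §8.2, §17.13.
-/

set_option autoImplicit false
set_option linter.dupNamespace false -- D-0017: single-problem summit, the namespace repeats the problem name by design
noncomputable section

open scoped Classical
open CategoryTheory Function NumberField IsDedekindDomain Field Polynomial

namespace Summit.BirchSwinnertonDyer.BirchSwinnertonDyer.Theorems.SmallImageRttD2Seq

open Literature.NumberTheory.GaloisRepresentations Literature.NumberTheory.GaloisCohomology Literature.NumberTheory.EllipticCurves
  Literature.NumberTheory.ComplexMultiplication.EllipticUnits Literature.NumberTheory.ComplexMultiplication.EllipticUnits.JohnsonLeungKings2011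
  Literature.NumberTheory.GaloisRepresentations.DiscreteGaloisModule Literature.NumberTheory.GaloisCohomology.PoitouTateFinite
  Literature.Algebra.Module.LocallyNilpotent
  Summit.BirchSwinnertonDyer.BirchSwinnertonDyer.Theorems.SmallImageRttD2J1 Summit.BirchSwinnertonDyer.BirchSwinnertonDyer.Theorems.SmallImageCharSignedSelmer

/-! ## §1. The unramified classes of a semilocal level form a `Λ_𝒪`-submodule -/

section Level

variable {K : Type} [Field K] [NumberField K] {p : ℕ} [Fact p.Prime] (S : Set (PadicAlgCl p)) (κ : ZpExtension K p)
  (γ : absoluteGaloisGroup K) (θ' : absoluteGaloisGroup K →ₜ* (padicCoeffIntegers S)ˣ) (P : Set (HeightOneSpectrum (𝓞 K))) (w : HeightOneSpectrum (𝓞 K))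

/-- **`H¹(res_w, φ)` preserves unramified classes** for every `Γ_K`-endomorphism `φ` of `Maps(Γ_K ⧸ U_n, X_k)` (`φ|_{Γ_{K_w}}` is a morphism of local modules; the tree's
`galoisCohomology.map_unramifiedSubgroup_le` in honda's dialect, `(resFunctor res_w).map φ = homOfIntertwining (φ.restrictField K_w)` by extensionality). [cite: MilneADT2006, Ch. I §2] -/
theorem semilocH_mem_unramifiedSubgroup (n k : ℕ)
    (φ : coindFin.{0, 0} (coeffRepK S θ' P k).toTopRep (κ.layerSubgroup n) ⟶ coindFin.{0, 0} (coeffRepK S θ' P k).toTopRep (κ.layerSubgroup n)) (t : semilocCoh S κ θ' P w n k 1)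
    (ht : letI := layerQuotFintype κ n
      t ∈ unramifiedSubgroup (GaloisRep.toLocal w (DiscreteGaloisModule.coind (coeffRepK S θ' P k) (κ.layerSubgroup n) (κ.isOpen_layerSubgroup n))) 1) :
    letI := layerQuotFintype κ n
    semilocH S κ θ' P w φ 1 t ∈ unramifiedSubgroup (GaloisRep.toLocal w (DiscreteGaloisModule.coind (coeffRepK S θ' P k) (κ.layerSubgroup n) (κ.isOpen_layerSubgroup n))) 1 := by
  letI := layerQuotFintype κ n
  let f : ContIntertwiningMap (DiscreteGaloisModule.coind (coeffRepK S θ' P k) (κ.layerSubgroup n) (κ.isOpen_layerSubgroup n)).toContRepresentation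
      (DiscreteGaloisModule.coind (coeffRepK S θ' P k) (κ.layerSubgroup n) (κ.isOpen_layerSubgroup n)).toContRepresentation :=
    { toContinuousLinearMap := φ.hom.toContinuousLinearMap, isIntertwining' := fun σ ↦ φ.hom.isIntertwining' σ }
  have hmor : (TopRep.resFunctor (resGalOfEmb (closureEmb (K := K) (w.adicCompletion K)) : absoluteGaloisGroup (w.adicCompletion K) →* absoluteGaloisGroup K)).map φ =
      DiscreteGaloisModule.homOfIntertwining (f.restrictField (w.adicCompletion K)) :=
    TopRep.hom_ext (ContIntertwiningMap.ext (ContinuousLinearMap.ext fun _ ↦ rfl))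
  have hmem := galoisCohomology.map_unramifiedSubgroup_le
    (τ := GaloisRep.toLocal w (DiscreteGaloisModule.coind (coeffRepK S θ' P k) (κ.layerSubgroup n) (κ.isOpen_layerSubgroup n)))
    (τ' := GaloisRep.toLocal w (DiscreteGaloisModule.coind (coeffRepK S θ' P k) (κ.layerSubgroup n) (κ.isOpen_layerSubgroup n)))
    (f.restrictField (w.adicCompletion K)) ⟨t, ht, rfl⟩
  rw [semilocH_apply, hmor]
  exact hmem

/-- Polynomials in `ψ_γ = R_γ − 1` with `𝒪`-coefficients preserve the unramified classes (`𝒪`-scalars and `R_γ` are of the form `H¹(res_w, φ)`). [cite: Kaplansky1954, §19] -/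
theorem aeval_semilocPsi_mem_unramifiedSubgroup (n k : ℕ) (Q : Polynomial (padicCoeffIntegers S)) (t : semilocCoh S κ θ' P w n k 1)
    (ht : letI := layerQuotFintype κ n
      t ∈ unramifiedSubgroup (GaloisRep.toLocal w (DiscreteGaloisModule.coind (coeffRepK S θ' P k) (κ.layerSubgroup n) (κ.isOpen_layerSubgroup n))) 1) :
    letI := layerQuotFintype κ n
    letI := semilocModuleO S κ θ' P w n k 1
    aeval (semilocPsi S κ θ' P w n k 1 γ) Q t ∈
      unramifiedSubgroup (GaloisRep.toLocal w (DiscreteGaloisModule.coind (coeffRepK S θ' P k) (κ.layerSubgroup n) (κ.isOpen_layerSubgroup n))) 1 := by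
  letI := layerQuotFintype κ n
  letI := semilocModuleO S κ θ' P w n k 1
  induction Q using Polynomial.induction_on generalizing t with
  | C a =>
    rw [aeval_C, Module.algebraMap_end_apply, semilocModuleO_smul]
    exact semilocH_mem_unramifiedSubgroup S κ θ' P w n k _ t ht
  | add Q R hQ hR => rw [map_add, LinearMap.add_apply]; exact add_mem (hQ t ht) (hR t ht)
  | monomial m a h =>
    rw [pow_succ, ← mul_assoc, map_mul, Module.End.mul_apply, aeval_X, semilocPsi_apply]
    exact h _ (sub_mem (semilocH_mem_unramifiedSubgroup S κ θ' P w n k _ t ht) ht)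

/-- ★ **The unramified classes of the semilocal level `Lloc_w(n,k)` form a `Λ_𝒪`-SUBMODULE** for T1-b₂'s level structure `semilocLayerModuleΛ` (`C a ↦ a ⊗ id`, `T ↦ R_γ − 1`): the action of
`F ∈ Λ_𝒪` on an element killed by `ψ^N` is that of the polynomial `trunc_N F` (`LocallyNilpotent.smul_eq_aeval_trunc_apply`). [cite: Kaplansky1954, §19] [cite: MilneADT2006, Ch. I §2] -/
def unramifiedLevelΛ (n k : ℕ) :
    letI := semilocLayerModuleΛ S κ γ θ' P w n k 1
    Submodule (IwasawaAlgebraO S) (semilocCoh S κ θ' P w n k 1) :=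
  letI := layerQuotFintype κ n
  letI := semilocModuleO S κ θ' P w n k 1
  letI := semilocLayerModuleΛ S κ γ θ' P w n k 1
  { carrier := {t | t ∈ unramifiedSubgroup (GaloisRep.toLocal w (DiscreteGaloisModule.coind (coeffRepK S θ' P k) (κ.layerSubgroup n) (κ.isOpen_layerSubgroup n))) 1}
    zero_mem' := show (0 : semilocCoh S κ θ' P w n k 1) ∈
        unramifiedSubgroup (GaloisRep.toLocal w (DiscreteGaloisModule.coind (coeffRepK S θ' P k) (κ.layerSubgroup n) (κ.isOpen_layerSubgroup n))) 1 from zero_mem _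
    add_mem' := fun {a b} ha hb ↦ show a + b ∈
        unramifiedSubgroup (GaloisRep.toLocal w (DiscreteGaloisModule.coind (coeffRepK S θ' P k) (κ.layerSubgroup n) (κ.isOpen_layerSubgroup n))) 1 from add_mem ha hb
    smul_mem' := fun F t ht ↦ by
      obtain ⟨hC, hX⟩ := semilocLayerModuleΛ_spec S κ γ θ' P w n k 1
      obtain ⟨N, hN⟩ := semilocPsi_locallyNilpotent S κ γ θ' P w n k 1 t
      show F • t ∈ unramifiedSubgroup (GaloisRep.toLocal w (DiscreteGaloisModule.coind (coeffRepK S θ' P k) (κ.layerSubgroup n) (κ.isOpen_layerSubgroup n))) 1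
      rw [smul_eq_aeval_trunc_apply hC hX hN F]
      exact aeval_semilocPsi_mem_unramifiedSubgroup S κ γ θ' P w n k _ t ht }

/-- Membership in `unramifiedLevelΛ` (definitional). [folklore] -/
theorem mem_unramifiedLevelΛ_iff (n k : ℕ) (t : semilocCoh S κ θ' P w n k 1) :
    t ∈ unramifiedLevelΛ S κ γ θ' P w n k ↔
      letI := layerQuotFintype κ n
      t ∈ unramifiedSubgroup (GaloisRep.toLocal w (DiscreteGaloisModule.coind (coeffRepK S θ' P k) (κ.layerSubgroup n) (κ.isOpen_layerSubgroup n))) 1 :=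
  Iff.rfl

end Level

/-! ## §2. The `(S₀ ∖ P)`-unramified families and `hPT` on them -/

section Families

variable {K : Type} [Field K] [NumberField K] {p : ℕ} [Fact p.Prime] (S : Set (PadicAlgCl p)) [FiniteDimensional ℚ_[p] (padicCoeffField S)] (κ : ZpExtension K p)
  (γ : absoluteGaloisGroup K) (θ' : absoluteGaloisGroup K →ₜ* (padicCoeffIntegers S)ˣ) (P : Set (HeightOneSpectrum (𝓞 K))) (S₀ : Set (HeightOneSpectrum (𝓞 K)))

omit [FiniteDimensional ℚ_[p] (padicCoeffField S)] in
set_option maxHeartbeats 1000000 in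
/-- For the CONSTRUCTED semilocal datum the `Λ_𝒪`-action is levelwise: `proj_{n,k} (F • y) = F •_{(n,k)} proj_{n,k} y` (definitional, `piSemilocLayerModuleΛ_smul_apply`). [folklore] -/
theorem proj_semilocIwasawaCohomologyDataO_smul (w : HeightOneSpectrum (𝓞 K)) (n k : ℕ) (F : IwasawaAlgebraO S) (y : (semilocIwasawaCohomologyDataO S κ γ θ' P w 1).H) :
    (semilocIwasawaCohomologyDataO S κ γ θ' P w 1).proj n k (F • y) =
      (letI := semilocLayerModuleΛ S κ γ θ' P w n k 1
       F • (semilocIwasawaCohomologyDataO S κ γ θ' P w 1).proj n k y) :=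
  piSemilocLayerModuleΛ_smul_apply S κ γ θ' P w 1 F _ n k

/-- ★★ **`H′` = the families `x ∈ Π_{w∈S₀} 𝐇¹_{Iw,w}` (constructed data) UNRAMIFIED AT EVERY LEVEL at the places of `S₀ ∖ P`**, a `Λ_𝒪`-submodule (the action is levelwise and each level's
unramified classes form a submodule, §1) — the module `H′` of T5's λ-assembly and of hypothesis (ii) of T4. [cite: Rubin2000, Thm. 1.7.3, App. B.3] [cite: Kato2004Asterisque, §8.2, §17.13] -/
def unramifiedFamilies : Submodule (IwasawaAlgebraO S) (∀ w : S₀, (semilocIwasawaCohomologyDataO S κ γ θ' P w 1).H) where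
  carrier := {x | ∀ (n k : ℕ) (w : S₀), (w : HeightOneSpectrum (𝓞 K)) ∉ P → (semilocIwasawaCohomologyDataO S κ γ θ' P w 1).proj n k (x w) ∈ unramifiedLevelΛ S κ γ θ' P w n k}
  zero_mem' := fun n k w _ ↦ by rw [Pi.zero_apply, map_zero]; exact zero_mem _
  add_mem' := fun hx hy n k w hw ↦ by rw [Pi.add_apply, map_add]; exact add_mem (hx n k w hw) (hy n k w hw)
  smul_mem' := fun F x hx n k w hw ↦ by
    rw [Pi.smul_apply, proj_semilocIwasawaCohomologyDataO_smul]
    exact (unramifiedLevelΛ S κ γ θ' P w n k).smul_mem F (hx n k w hw)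

omit [FiniteDimensional ℚ_[p] (padicCoeffField S)] in
/-- Membership in `unramifiedFamilies` in T4's currency (`unramifiedSubgroup` of the local coinduced module). [folklore] -/
theorem mem_unramifiedFamilies_iff (x : ∀ w : S₀, (semilocIwasawaCohomologyDataO S κ γ θ' P w 1).H) :
    x ∈ unramifiedFamilies S κ γ θ' P S₀ ↔ ∀ n k : ℕ, letI := layerQuotFintype κ n
      ∀ (w : HeightOneSpectrum (𝓞 K)) (hw : w ∈ S₀), w ∉ P → (semilocIwasawaCohomologyDataO S κ γ θ' P w 1).proj n k (x ⟨w, hw⟩) ∈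
        unramifiedSubgroup (GaloisRep.toLocal w (DiscreteGaloisModule.coind (coeffRepK S θ' P k) (κ.layerSubgroup n) (κ.isOpen_layerSubgroup n))) 1 :=
  ⟨fun h n k w hw hwP ↦ (mem_unramifiedLevelΛ_iff S κ γ θ' P w n k _).1 (h n k ⟨w, hw⟩ hwP),
    fun h n k w hwP ↦ (mem_unramifiedLevelΛ_iff S κ γ θ' P (w : HeightOneSpectrum (𝓞 K)) n k _).2 (h n k (w : HeightOneSpectrum (𝓞 K)) w.property hwP)⟩

variable (v : HeightOneSpectrum (𝓞 K)) (M : Type) [AddCommGroup M] [TopologicalSpace M] [DiscreteTopology M] [DistribMulAction (absoluteGaloisGroup K) M]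
  [Module (padicCoeffIntegers S) M] [SMulCommClass (absoluteGaloisGroup K) (padicCoeffIntegers S) M]
  (hstabK : ∀ m : M, IsOpen (MulAction.stabilizer (absoluteGaloisGroup K) m : Set (absoluteGaloisGroup K)))
  (PG : ∀ k : ℕ, ContPairing (coeffRepK S θ' P k).toTopRep (torsRep M hstabK p k).toTopRep (mu K (p ^ k)).toTopRep)
  (hPred : ∀ (k : ℕ) (x : ↥(Representation.invariants ((muTwistO S θ' (k + 1)).toRepresentation.comp (ramificationSubgroup K P).subtype))) (m : ↥(torsionPow M p k)),
    (PG (k + 1)).toLin x (AddSubgroup.inclusion (torsionPow_mono (M := M) (p := p) (Nat.le_succ k)) m) =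
      muInclusion K (pow_dvd_pow p (Nat.le_succ k)) ((PG k).toLin (coeffMapO S P θ' (oMuRed S k) (oMuRed_muTwistO S θ' k) x) m))
  (hM : ∀ m : M, ∃ k : ℕ, p ^ k • m = 0)
  (V : WeierstrassCurve K) (j : V.geomPrimaryTorsion p →+ M) (hS₀ : S₀.Finite) (ε : ℤˣ)
  (hvp : ((p : ℕ) : 𝓞 K) ∈ v.asIdeal) (hpv : ∀ w : HeightOneSpectrum (𝓞 K), ((p : ℕ) : 𝓞 K) ∈ w.asIdeal → w = v)
  (S₁ : Set (HeightOneSpectrum (𝓞 K))) (hS₀S₁ : S₀ ⊆ S₁)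

include hpv in
/-- ★★ **T5's kernel hypothesis `hPT` ON `H′`, VERBATIM**: for the constructed semilocal data (`γ`-orientation `γ⁻¹` as honda's `I`), an `(S₀ ∖ P)`-unramified family `x ∈ H′` with `Φ x = 0` lies in
`range sloc_{S₀}` (N2d (γ) `exists_semilocMap_eq_of_phiLocImage_eq_zero` + `semilocMapPi_apply`). [cite: Rubin2000, Thm. 1.7.3, App. B.3] [cite: MilneADT2006, Ch. I, Thm. 4.10(b)] -/
theorem mem_range_semilocMapPi_of_phiLocImage_eq_zero {γv : absoluteGaloisGroup (v.adicCompletion K)}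
    (𝓛 : letI := localAction (closureEmb (K := K) (v.adicCompletion K)) M
      haveI := smulCommClass_localAction (R := padicCoeffIntegers S) M v
      LayerPairing S M γv κ γ⁻¹ θ' P)
    (hvS₀ : v ∉ S₀) (hvP : v ∈ P) (hP : P.Finite) (hPS₀ : ∀ w ∈ P, w ∉ S₀ → w = v) (hNP : ∀ n, ramificationSubgroup K P ≤ κ.layerSubgroup n)
    (hperf : ∀ k : ℕ, Bijective fun a : ↥(torsionPow M p k) ↦ (PG k).toLin.flip a) (I : CycIwasawaCohomologyDataO S κ γ⁻¹ θ' P 1)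
    (x : ∀ w : S₀, (semilocIwasawaCohomologyDataO S κ γ⁻¹ θ' P w 1).H) (hxU : x ∈ unramifiedFamilies S κ γ⁻¹ θ' P S₀)
    (hx : letI := localAction (closureEmb (K := K) (v.adicCompletion K)) M
      phiLocImage S κ γ θ' P M hstabK PG hPred hM V j S₀ hS₀ ε v (fun _ _ ↦ rfl) hvp (fun w ↦ semilocIwasawaCohomologyDataO S κ γ⁻¹ θ' P w 1) S₁ hS₀S₁ x = 0) :
    x ∈ LinearMap.range (semilocMapPi hNP S₀ I fun w ↦ semilocIwasawaCohomologyDataO S κ γ⁻¹ θ' P w 1) := by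
  obtain ⟨b, hb⟩ := exists_semilocMap_eq_of_phiLocImage_eq_zero S κ γ θ' P v M hstabK PG hPred hM V j S₀ hS₀ ε hvp hpv
    (fun w ↦ semilocIwasawaCohomologyDataO S κ γ⁻¹ θ' P w 1) S₁ hS₀S₁ 𝓛 hvS₀ hvP hP hPS₀ hNP hperf I x
    ((mem_unramifiedFamilies_iff S κ γ⁻¹ θ' P S₀ x).1 hxU) hx
  exact ⟨b, funext fun w ↦ (semilocMapPi_apply hNP S₀ I _ b w).trans (hb w)⟩

end Families

end Summit.BirchSwinnertonDyer.BirchSwinnertonDyer.Theorems.SmallImageRttD2Seq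

end
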